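import Literature.IUT.LogVolume.ArchimedeanTensorCopies
import HarnessLib

/-!
# [IUTchIV] Proposition 1.5 (iii), (iv): proofs, I — characters of `M_I`, (iv), the count, uniqueness

Mochizuki, *Inter-universal Teichmüller theory IV*, RIMS manuscript (Apr. 2020; = PRIMS **57** (2021)),
§1, Proposition 1.5 (iii), (iv), pp. 15–16 (kurims `paper:url-56bcb0f95768`). PROOF-ONLY companion
(no definitions) of `Literature.IUT.LogVolume.ArchimedeanTensorCopies` (the statements, typed over
Mathlib's `PiTensorProduct`). Classical content; the tag form only reflects the series' key. PROVED here:

* `algHom_pi_eq` — every `ℝ`-algebra homomorphism `⊕_{j∈J} ℂ → ℂ` is "a coordinate, then `id` or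
  `conj`"; `exists_eq_character` — every `ℝ`-algebra homomorphism `M_I → ℂ` is a character `χ_{w,ε}`
  (`PiTensorProduct.algHom_ext`); `character_injective`, `nonempty_charEquiv`
  (`(M_I →ₐ ℂ) ≃ V^I × {±}^I`), `nonempty_piCharEquiv` (`((⊕_J ℂ) →ₐ ℂ) ≃ J × {±}`);
* `exists_coord_eq_character`, `norm_coord_tprod` — the coordinates of ANY direct sum decomposition
  are characters, of absolute value `∏_i |m_i(w_i)|` on a pure tensor `⊗ m_i`;
* **`prop15iv_holds : Prop15iv I V`** — Prop. 1.5 (iv) for every direct sum decomposition;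
* **`card_eq_of_decomposition`** — EVERY decomposition of `M_I` (`I ≠ ∅`) into copies of `ℂ` has exactly
  `2^{|I|−1}·|V|^{|I|}` copies (count `ℝ`-algebra homomorphisms to `ℂ`: `|V|^{|I|}·2^{|I|} = 2·|J|`);
* **`prop15iii_unique_holds : Prop15iii_unique I V`** — "unique": two decompositions differ by a
  bijection of index sets and coordinatewise `id`/`conj`.

Existence of the decomposition, the `2^{|I|−1}` metric comparison and the invariance clause are proved in
`ArchimedeanTensorCopiesDecomposition` / `ArchimedeanTensorCopiesInvariance`. Nothing here takes a side
on [IUTchIII] Cor. 3.12; typed ≠ discharged elsewhere.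
-/

noncomputable section

namespace Literature.IUT.LogVolume

namespace Prop15iii

open scoped TensorProduct ComplexConjugate
open Complex PiTensorProduct

variable (I V : Type) [Fintype I]

/-- For the `i`-th factor embedding `m ↦ 1 ⊗ ⋯ ⊗ m ⊗ ⋯ ⊗ 1`, only the `i`-th factor of the character
survives (Prop. 1.5 (iii), p. 15). [claim: Mochizuki2012, status: disputed] -/
theorem prod_cj_mulSingle [DecidableEq I] (ε : I → Bool) (w : I → V) (i : I) (m : M V) :
    ∏ i', cj (ε i') ((Pi.mulSingle i m : I → M V) i' (w i')) = cj (ε i) (m (w i)) := by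
  rw [Finset.prod_eq_single i]
  · simp
  · intro i' _ hi'
    simp [Pi.mulSingle_eq_of_ne hi']
  · simp

/-- `χ_{w,ε}` on the `i`-th factor embedding: `χ_{w,ε}(1 ⊗ ⋯ ⊗ m ⊗ ⋯ ⊗ 1) = cj(ε_i)(m(w_i))`.
[claim: Mochizuki2012, status: disputed] -/
theorem character_singleAlgHom [DecidableEq I] (w : I → V) (ε : I → Bool) (i : I) (m : M V) :
    character I V w ε ((singleAlgHom (R := ℝ) (A := fun _ : I => M V) i) m) =
      cj (ε i) (m (w i)) := by
  rw [singleAlgHom_apply, character_tprod]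
  exact prod_cj_mulSingle I V ε w i m

/-! ## `ℝ`-algebra homomorphisms `⊕_j ℂ → ℂ` and `M_I → ℂ` -/

/-- An idempotent complex number is `0` or `1`. [folklore] -/
private theorem eq_zero_or_one_of_mul_self {z : ℂ} (h : z * z = z) : z = 0 ∨ z = 1 := by
  have : z * (z - 1) = 0 := by rw [mul_sub, mul_one, h, sub_self]
  rcases mul_eq_zero.mp this with h0 | h1
  · exact Or.inl h0
  · exact Or.inr (sub_eq_zero.mp h1)

/-- Every `ℝ`-algebra homomorphism `⊕_{j ∈ J} ℂ → ℂ` (finite `J`) is "evaluate at one coordinate `j`,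
then apply the identity or complex conjugation" (the mechanism behind "unique" in Prop. 1.5 (iii), p. 15). [claim: Mochizuki2012, status: disputed] -/
theorem algHom_pi_eq (J : Type) [Fintype J] [DecidableEq J] (φ : (J → ℂ) →ₐ[ℝ] ℂ) :
    ∃ (j : J) (b : Bool), ∀ m, φ m = cj b (m j) := by
  have hidem : ∀ j, φ (Pi.single j 1) = 0 ∨ φ (Pi.single j 1) = 1 := fun j =>
    eq_zero_or_one_of_mul_self (by rw [← map_mul, ← Pi.single_mul, mul_one])
  have hone : (∑ j : J, (Pi.single j (1 : ℂ) : J → ℂ)) = 1 := by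
    ext k
    simp [Finset.sum_apply, Pi.single_apply]
  have hsum : ∑ j, φ (Pi.single j 1) = 1 := by
    rw [← map_sum, hone, map_one]
  obtain ⟨j, hj⟩ : ∃ j, φ (Pi.single j 1) = 1 := by
    by_contra h
    have h0 : ∑ j, φ (Pi.single j 1) = 0 :=
      Finset.sum_eq_zero fun j _ => (hidem j).resolve_right fun hj => h ⟨j, hj⟩
    rw [h0] at hsum
    exact zero_ne_one hsum
  obtain ⟨b, hb⟩ := exists_eq_cj (φ.comp (Pi.constAlgHom ℝ J ℂ))
  refine ⟨j, b, fun m => ?_⟩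
  have hsplit : m = (fun _ => m j) * Pi.single j 1 + m * (1 - Pi.single j 1) := by
    ext k
    by_cases hk : k = j
    · subst hk; simp
    · simp [hk]
  have h0 : φ (1 - Pi.single j 1) = 0 := by rw [map_sub, map_one, hj, sub_self]
  have hconst : φ (fun _ => m j) = cj b (m j) := by
    have := congrArg (fun f => f (m j)) hb
    simp only [AlgHom.comp_apply] at this
    exact this
  calc φ m = φ ((fun _ => m j) * Pi.single j 1) + φ (m * (1 - Pi.single j 1)) := by
        conv_lhs => rw [hsplit]
        rw [map_add]
    _ = cj b (m j) := by rw [map_mul, map_mul, hj, h0, mul_one, mul_zero, add_zero, hconst]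

/-- **Classification of the characters of `M_I`**: every `ℝ`-algebra homomorphism `M_I → ℂ` is one
of the `χ_{w,ε}` (each factor `M_i → M_I → ℂ` is a homomorphism `⊕_v ℂ_v → ℂ`, `algHom_pi_eq`, and an
algebra homomorphism out of `M_I` is determined by its restrictions to the factors,
`PiTensorProduct.algHom_ext`). [claim: Mochizuki2012, status: disputed] -/
theorem exists_eq_character [DecidableEq I] [Fintype V] [DecidableEq V] (χ : MI I V →ₐ[ℝ] ℂ) :
    ∃ (w : I → V) (ε : I → Bool), χ = character I V w ε := by
  choose w ε hwε using fun i =>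
    algHom_pi_eq V (χ.comp (singleAlgHom (R := ℝ) (A := fun _ : I => M V) i))
  refine ⟨w, ε, PiTensorProduct.algHom_ext fun i => ?_⟩
  ext m
  rw [AlgHom.comp_apply, AlgHom.comp_apply, character_singleAlgHom]
  exact hwε i m

/-- `√−1 ≠ −√−1`. [folklore] -/
private theorem I_ne_neg_I : Complex.I ≠ -Complex.I := by
  intro h
  have := congrArg Complex.im h
  norm_num at this

/-- Distinct data `(w, ε)` give distinct characters. [claim: Mochizuki2012, status: disputed] -/
theorem character_injective [DecidableEq I] [DecidableEq V] :
    Function.Injective fun p : (I → V) × (I → Bool) => character I V p.1 p.2 := by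
  rintro ⟨w, ε⟩ ⟨w', ε'⟩ h
  simp only at h
  have hw : w = w' := by
    funext i
    by_contra hne
    have h1 := congrArg
      (fun χ : MI I V →ₐ[ℝ] ℂ => χ (singleAlgHom (R := ℝ) (A := fun _ : I => M V) i
        (Pi.single (w i) (1 : ℂ)))) h
    simp only [character_singleAlgHom, Pi.single_eq_same, map_one,
      Pi.single_eq_of_ne' hne, map_zero] at h1
    exact one_ne_zero h1
  subst hw
  have hε : ε = ε' := by
    funext i
    have h1 := congrArg
      (fun χ : MI I V →ₐ[ℝ] ℂ => χ (singleAlgHom (R := ℝ) (A := fun _ : I => M V) i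
        (fun _ => Complex.I))) h
    simp only [character_singleAlgHom] at h1
    cases hi : ε i <;> cases hi' : ε' i <;> simp_all [cj, conj_I] <;>
      first | exact I_ne_neg_I h1 | exact I_ne_neg_I h1.symm
  rw [hε]

/-- The characters of `M_I` are in bijection with the data `(w, ε) ∈ V^I × {±}^I` (`|V|^{|I|}·2^{|I|}`
of them). [claim: Mochizuki2012, status: disputed] -/
theorem nonempty_charEquiv [DecidableEq I] [Fintype V] [DecidableEq V] :
    Nonempty ((I → V) × (I → Bool) ≃ (MI I V →ₐ[ℝ] ℂ)) :=
  ⟨Equiv.ofBijective (fun p => character I V p.1 p.2)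
    ⟨character_injective I V, fun χ => by
      obtain ⟨w, ε, h⟩ := exists_eq_character I V χ
      exact ⟨(w, ε), h.symm⟩⟩⟩

/-- The `ℝ`-algebra homomorphisms `⊕_{j∈J} ℂ → ℂ` are in bijection with `J × {±}` (counting the
copies of `ℂ`, Prop. 1.5 (iii), p. 15). [claim: Mochizuki2012, status: disputed] -/
theorem nonempty_piCharEquiv (J : Type) [Fintype J] [DecidableEq J] :
    Nonempty (J × Bool ≃ ((J → ℂ) →ₐ[ℝ] ℂ)) :=
  ⟨Equiv.ofBijective (fun p => (cj p.2).comp (Pi.evalAlgHom ℝ (fun _ : J => ℂ) p.1))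
    ⟨by
      rintro ⟨j, b⟩ ⟨j', b'⟩ h
      simp only at h
      have hj : j = j' := by
        by_contra hne
        have h1 := congrArg (fun χ : (J → ℂ) →ₐ[ℝ] ℂ => χ (Pi.single j (1 : ℂ))) h
        simp only [AlgHom.comp_apply, Pi.evalAlgHom_apply, Pi.single_eq_same, map_one,
          Pi.single_eq_of_ne' hne, map_zero] at h1
        exact one_ne_zero h1
      subst hj
      have hb : b = b' := by
        have h1 := congrArg (fun χ : (J → ℂ) →ₐ[ℝ] ℂ => χ (fun _ => Complex.I)) h
        simp only [AlgHom.comp_apply, Pi.evalAlgHom_apply] at h1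
        cases b <;> cases b' <;> simp_all [cj, conj_I] <;>
          first | exact I_ne_neg_I h1 | exact I_ne_neg_I h1.symm
      rw [hb],
     fun φ => by
      obtain ⟨j, b, h⟩ := algHom_pi_eq J φ
      exact ⟨(j, b), by ext m; simp [h]⟩⟩⟩

/-! ## Proofs: the coordinates of a decomposition are characters; (iv); the count; uniqueness -/

variable {I V}

/-- Each coordinate of a direct sum decomposition is a character `χ_{w,ε}` of `M_I`.
[claim: Mochizuki2012, status: disputed] -/
theorem exists_coord_eq_character [DecidableEq I] [Fintype V] [DecidableEq V] {J : Type}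
    (Φ : Decomposition I V J) (j : J) :
    ∃ (w : I → V) (ε : I → Bool), ∀ x, Φ x j = character I V w ε x := by
  obtain ⟨w, ε, h⟩ :=
    exists_eq_character I V ((Pi.evalAlgHom ℝ (fun _ : J => ℂ) j).comp (Φ : MI I V →ₐ[ℝ] (J → ℂ)))
  refine ⟨w, ε, fun x => ?_⟩
  have := congrArg (fun χ : MI I V →ₐ[ℝ] ℂ => χ x) h
  simpa using this

/-- On a pure tensor every coordinate of a decomposition has absolute value `∏_i |m_i(w_i)|` for some
`w`. [claim: Mochizuki2012, status: disputed] -/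
theorem norm_coord_tprod [DecidableEq I] [Fintype V] [DecidableEq V] {J : Type}
    (Φ : Decomposition I V J) (j : J) (m : I → M V) :
    ∃ w : I → V, ‖Φ (tprod ℝ m) j‖ = ∏ i, ‖m i (w i)‖ := by
  obtain ⟨w, ε, h⟩ := exists_coord_eq_character Φ j
  refine ⟨w, ?_⟩
  rw [h, character_tprod, norm_prod]
  simp

open Pointwise in
/-- **Prop. 1.5 (iv) holds** (for every direct sum decomposition): if every `ℂ_v`-component of every
`m_i` has length `r`, then every coordinate of `⊗_i m_i` has absolute value `r^{|I|}`, so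
`⊗_i m_i ∈ r^{|I|}·B_I`. [claim: Mochizuki2012, status: disputed] -/
theorem prop15iv_holds [DecidableEq I] [Fintype V] [DecidableEq V] : Prop15iv I V := by
  intro J _ Φ r hr m hm
  refine ⟨(r ^ Fintype.card I)⁻¹ • tprod ℝ m, fun j => ?_, ?_⟩
  · obtain ⟨w, hw⟩ := norm_coord_tprod Φ j m
    rw [map_smul, Pi.smul_apply, norm_smul, hw, Real.norm_eq_abs, abs_inv, abs_pow, abs_of_pos hr]
    simp only [hm, Finset.prod_const, Finset.card_univ]
    rw [inv_mul_cancel₀ (pow_ne_zero _ hr.ne')]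
  · simp only [smul_smul, mul_inv_cancel₀ (pow_ne_zero _ hr.ne'), one_smul]

/-- **The number of copies**: EVERY direct sum decomposition of `M_I` (`I ≠ ∅`) into copies of `ℂ` has
exactly `2^{|I|−1}·|V|^{|I|}` copies — count the `ℝ`-algebra homomorphisms to `ℂ` on both sides:
`|V|^{|I|}·2^{|I|} = |J|·2`. [claim: Mochizuki2012, status: disputed] -/
theorem card_eq_of_decomposition [DecidableEq I] [Fintype V] [DecidableEq V] [Nonempty I] {J : Type}
    [Fintype J] [DecidableEq J] (Φ : Decomposition I V J) :
    Fintype.card J = 2 ^ (Fintype.card I - 1) * Fintype.card V ^ Fintype.card I := by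
  obtain ⟨e₁⟩ := nonempty_charEquiv I V
  obtain ⟨e₂⟩ := nonempty_piCharEquiv J
  have e : (I → V) × (I → Bool) ≃ J × Bool :=
    (e₁.trans (AlgEquiv.arrowCongr Φ AlgEquiv.refl)).trans e₂.symm
  have h := Fintype.card_congr e
  simp only [Fintype.card_prod, Fintype.card_fun, Fintype.card_bool] at h
  obtain ⟨n, hn⟩ := Nat.exists_eq_succ_of_ne_zero (Fintype.card_ne_zero (α := I))
  rw [hn] at h
  rw [hn, Nat.succ_sub_one]
  have h2 : Fintype.card J * 2 = (2 ^ n * Fintype.card V ^ (n + 1)) * 2 := by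
    rw [← h]; simp only [Nat.succ_eq_add_one]; ring
  exact Nat.eq_of_mul_eq_mul_right (by norm_num) h2

omit [Fintype I] in
/-- **Prop. 1.5 (iii), "unique", holds**: two decompositions differ by a bijection of index sets and
coordinatewise `id`/`conj` (each coordinate of `Φ'` is an `ℝ`-algebra homomorphism `⊕_j ℂ → ℂ` through
`Φ`, `algHom_pi_eq`). [claim: Mochizuki2012, status: disputed] -/
theorem prop15iii_unique_holds : Prop15iii_unique I V := by
  intro J J' _ _ _ _ Φ Φ'
  -- each coordinate of `Φ'` factors through one coordinate of `Φ`
  have key : ∀ j' : J', ∃ (j : J) (b : Bool), ∀ x, Φ' x j' = cj b (Φ x j) := by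
    intro j'
    obtain ⟨j, b, h⟩ := algHom_pi_eq J
      (((Pi.evalAlgHom ℝ (fun _ : J' => ℂ) j').comp (Φ' : MI I V →ₐ[ℝ] (J' → ℂ))).comp
        (Φ.symm : (J → ℂ) →ₐ[ℝ] MI I V))
    refine ⟨j, b, fun x => ?_⟩
    have := h (Φ x)
    simpa using this
  choose f c hfc using key
  -- and symmetrically
  have key' : ∀ j : J, ∃ (j' : J') (b : Bool), ∀ x, Φ x j = cj b (Φ' x j') := by
    intro j
    obtain ⟨j', b, h⟩ := algHom_pi_eq J'
      (((Pi.evalAlgHom ℝ (fun _ : J => ℂ) j).comp (Φ : MI I V →ₐ[ℝ] (J → ℂ))).comp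
        (Φ'.symm : (J' → ℂ) →ₐ[ℝ] MI I V))
    refine ⟨j', b, fun x => ?_⟩
    have := h (Φ' x)
    simpa using this
  choose g c' hgc using key'
  have hf : Function.Injective f := by
    intro j₁ j₂ hj
    by_contra hne
    have h1 := hfc j₁ (Φ'.symm (Pi.single j₁ 1))
    have h2 := hfc j₂ (Φ'.symm (Pi.single j₁ 1))
    rw [AlgEquiv.apply_symm_apply, Pi.single_eq_same] at h1
    rw [AlgEquiv.apply_symm_apply, Pi.single_eq_of_ne' hne] at h2
    have h1' := congrArg (fun z : ℂ => ‖z‖) h1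
    have h2' := congrArg (fun z : ℂ => ‖z‖) h2
    simp only [norm_one, norm_zero, norm_cj, hj] at h1' h2'
    rw [← h2'] at h1'
    exact one_ne_zero h1'
  have hg : Function.Injective g := by
    intro j₁ j₂ hj
    by_contra hne
    have h1 := hgc j₁ (Φ.symm (Pi.single j₁ 1))
    have h2 := hgc j₂ (Φ.symm (Pi.single j₁ 1))
    rw [AlgEquiv.apply_symm_apply, Pi.single_eq_same] at h1
    rw [AlgEquiv.apply_symm_apply, Pi.single_eq_of_ne' hne] at h2
    have h1' := congrArg (fun z : ℂ => ‖z‖) h1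
    have h2' := congrArg (fun z : ℂ => ‖z‖) h2
    simp only [norm_one, norm_zero, norm_cj, hj] at h1' h2'
    rw [← h2'] at h1'
    exact one_ne_zero h1'
  have hcard : Fintype.card J = Fintype.card J' :=
    le_antisymm (Fintype.card_le_of_injective g hg) (Fintype.card_le_of_injective f hf)
  have hfb : Function.Bijective f :=
    (Fintype.bijective_iff_injective_and_card f).mpr ⟨hf, hcard.symm⟩
  refine ⟨(Equiv.ofBijective f hfb).symm, fun j => c ((Equiv.ofBijective f hfb).symm j),
    fun x j => ?_⟩
  have := hfc ((Equiv.ofBijective f hfb).symm j) x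
  rw [this, Equiv.ofBijective_apply_symm_apply f hfb j]

omit [Fintype I] in
/-- `Prop15iii_unique` — `_holds` alias of `prop15iii_unique_holds` above under the fact's exact name (appended
2026-08-28, D-0026 bookkeeping: the proof term is the existing theorem of this file; no statement,
definition or attribute is edited; no new named fact; the ledger's debt table listed the fact
unproved). [claim: Mochizuki2012, status: disputed] -/
theorem _root_.Literature.IUT.LogVolume.Prop15iii.Prop15iii_unique_holds : Prop15iii_unique I V :=
  _root_.Literature.IUT.LogVolume.Prop15iii.prop15iii_unique_holds (I := I) (V := V)

end Prop15iii

end Literature.IUT.LogVolume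

end
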